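import Mathlib
import HarnessLib
import Summits.HubbardSuperconductivity.HubbardSuperconductivity.Theorems.KLProgrammeKLRegimeVolumeLimitSixPointWordFourier

/-!
# Child `KLRegimeVolumeLimitV12` (stmt-HubbardSuperconductivity-19858), stub `stub_vl_bound` — the six-point insertion as a TIME-INTEGRAL
# Fourier coefficient of the lane's six-point word, and the `L¹`-majorant (seat hubbard-kl-k3c5-p3, «OS-positivity-free direct assembly»)

`…SixPointWordFourier` extracted the label-`k` current–current insertion `b(k,↑) = ∫e^{−V}(∂⁺_{k↑}W)(∂⁻_{k↑}W)` from the word six-point function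
`S(z,u) = ∫dμ_C e^{−V}·sixPointWord L M β 0 1 z u` by a DISCRETE time average over a grid of `N > 4M` points.  Since `S(z,·)` is a trigonometric
polynomial whose frequencies against `e^{−iω_k u}` are integer multiples of `2π/β` of modulus `≤ 4M`, the grid average IS the time integral; this
module proves the integral form directly:

  `βL² · b(k,↑) = ∫₀^β ( Σ_z e^{−iω_k u} conj χ_{k⃗}(z) · S(z,u) ) du`     (`sixPoint_up_eq_integral_word`, `β > 0`, every `U`, `L`, `M`),

whence the `L¹` MAJORANT `βL²·‖b(k,↑)‖ ≤ ∫₀^β Σ_z ‖S(z,u)‖ du` for EVERY label `k` (`norm_sixPoint_up_le_integral_word`).  This is the form the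
`M → ∞` step consumes: applied to the DIFFERENCE of two cutoffs it bounds `sup_k ‖b_M(k) − b_{M'}(k)‖` by the `L¹(torus × [0,β])`-distance of the
two word six-point functions, so dominated convergence in `u` (t2's all-`U` machine on k3c5-p1's `sixPointWord`, `…SixPointDefs`) gives the
label-UNIFORM Cauchy property at fixed `L` — TAU-BRIDGE.md §6 Step 3 (HOME/hubbard-kl-k3c5-p2).  Everything is proved; no definition.
-/

noncomputable section

namespace Summit.HubbardSuperconductivity.HubbardSuperconductivity.Theorems.TwoPointAssembly

set_option linter.dupNamespace false -- summit = problem name (single-conjunct summit), D-0017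

open Finset Filter Topology MeasureTheory intervalIntegral Literature.MathematicalPhysics.QuantumLattice Literature.Probability.LatticeModels
  GrassmannAlgebra
open Summit.HubbardSuperconductivity.HubbardSuperconductivity.Theorems.KLRegimeSplit
open Summit.HubbardSuperconductivity.HubbardSuperconductivity.Theorems.KLProgrammeLegKernels
open scoped ComplexConjugate

variable {L M : ℕ} [NeZero L]

/-! ## §1 Time orthogonality as an integral -/

omit [NeZero L] in
/-- **Continuous orthogonality on `[0, β]`**: `∫₀^β e^{2πi m u/β} du = β·[m = 0]` for an integer `m` (`β ≠ 0`). -/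
theorem integral_exp_freqTransfer {β : ℝ} (hβ : β ≠ 0) (m : ℤ) :
    ∫ u in (0 : ℝ)..β, Complex.exp (((2 * Real.pi * m * u / β : ℝ) : ℂ) * Complex.I) = if m = 0 then (β : ℂ) else 0 := by
  by_cases hm : m = 0
  · subst hm
    simp
  · rw [if_neg hm]
    set c : ℂ := ((2 * Real.pi * m / β : ℝ) : ℂ) * Complex.I with hc
    have hc0 : c ≠ 0 := by
      have hm' : (m : ℝ) ≠ 0 := by exact_mod_cast hm
      have : (2 * Real.pi * m / β : ℝ) ≠ 0 := by positivity
      exact mul_ne_zero (by exact_mod_cast this) Complex.I_ne_zero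
    have hfun : (fun u : ℝ => Complex.exp (((2 * Real.pi * m * u / β : ℝ) : ℂ) * Complex.I)) = fun u : ℝ => Complex.exp (c * u) := by
      funext u
      congr 1
      rw [hc]
      push_cast
      ring
    rw [hfun, integral_exp_mul_complex hc0]
    have hβ' : (β : ℂ) ≠ 0 := by exact_mod_cast hβ
    have h1 : Complex.exp (c * (β : ℝ)) = 1 := by
      have : c * (β : ℝ) = (m : ℂ) * (2 * Real.pi * Complex.I) := by
        rw [hc]
        push_cast
        field_simp
      rw [this, Complex.exp_int_mul_two_pi_mul_I]
    rw [h1]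
    simp

omit [NeZero L] in
/-- The leg phases are continuous in the time. -/
theorem continuous_conj_vertexPlaneWave_time (β : ℝ) (c : Fin 2) (k : FreqMomentum L M) (z : TorusSite 2 L) :
    Continuous fun u : ℝ => conj (vertexPlaneWave L M β c k z u) := by
  unfold vertexPlaneWave vertexPhase
  fun_prop

/-- **The time integral of the conjugate leg phases of one `J̄`-triple, summed over the torus** (`β ≠ 0`):
`∫₀^β Σ_z e^{−iω_k u} conj χ_k(z) a⁰_{k₁}a⁰_{k₃}a¹_{k₄}(z,u) du = (βL²)⁻³ · β[n₁+n₃ = n_k+n₄] · L²[k⃗₁+k⃗₃ = k⃗+k⃗₄]`. -/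
theorem integral_sum_phases_currentBar_up {β : ℝ} (hβ : β ≠ 0) (k k₁ k₃ k₄ : FreqMomentum L M) :
    ∫ u in (0 : ℝ)..β, ∑ z : TorusSite 2 L,
        Complex.exp (-(((matsubaraFreq β M k.1 * u : ℝ) : ℂ) * Complex.I)) * conj (torusChar k.2 z) *
          ((((1 / (β * (L : ℝ) ^ 2) : ℝ) : ℂ) * conj (vertexPlaneWave L M β 0 k₁ z u)) *
            ((((1 / (β * (L : ℝ) ^ 2) : ℝ) : ℂ) * conj (vertexPlaneWave L M β 0 k₃ z u)) *
              (((1 / (β * (L : ℝ) ^ 2) : ℝ) : ℂ) * conj (vertexPlaneWave L M β 1 k₄ z u)))) =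
      (((1 / (β * (L : ℝ) ^ 2)) ^ 3 : ℝ) : ℂ) *
        ((if matsubaraInt M k₁.1 + matsubaraInt M k₃.1 = matsubaraInt M k.1 + matsubaraInt M k₄.1 then (β : ℂ) else 0) *
          (if k₁.2 + k₃.2 = k.2 + k₄.2 then ((L : ℂ) ^ 2) else 0)) := by
  have hterm : ∀ (u : ℝ) (z : TorusSite 2 L),
      Complex.exp (-(((matsubaraFreq β M k.1 * u : ℝ) : ℂ) * Complex.I)) * conj (torusChar k.2 z) *
          ((((1 / (β * (L : ℝ) ^ 2) : ℝ) : ℂ) * conj (vertexPlaneWave L M β 0 k₁ z u)) *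
            ((((1 / (β * (L : ℝ) ^ 2) : ℝ) : ℂ) * conj (vertexPlaneWave L M β 0 k₃ z u)) *
              (((1 / (β * (L : ℝ) ^ 2) : ℝ) : ℂ) * conj (vertexPlaneWave L M β 1 k₄ z u)))) =
        (((1 / (β * (L : ℝ) ^ 2)) ^ 3 : ℝ) : ℂ) *
          (Complex.exp (((2 * Real.pi *
              ((matsubaraInt M k₁.1 - matsubaraInt M k.1 + matsubaraInt M k₃.1 - matsubaraInt M k₄.1 : ℤ) : ℝ) * u / β : ℝ) : ℂ) *
                Complex.I) *
            torusChar (k₁.2 - k.2 + k₃.2 - k₄.2) z) := by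
    intro u z
    rw [← timePhases_bar_eq_exp_transfer β k k₁ k₃ k₄, ← torusChars_bar_eq_torusChar_transfer, conj_vertexPlaneWave_zero_eq,
      conj_vertexPlaneWave_zero_eq, conj_vertexPlaneWave_one_eq]
    push_cast
    ring
  simp_rw [hterm, ← Finset.mul_sum, sum_torusChar_right]
  rw [intervalIntegral.integral_const_mul, intervalIntegral.integral_mul_const, integral_exp_freqTransfer hβ]
  have hfreq : (matsubaraInt M k₁.1 - matsubaraInt M k.1 + matsubaraInt M k₃.1 - matsubaraInt M k₄.1 = 0) ↔
      matsubaraInt M k₁.1 + matsubaraInt M k₃.1 = matsubaraInt M k.1 + matsubaraInt M k₄.1 := by omega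
  have hmom : (k₁.2 - k.2 + k₃.2 - k₄.2 = 0) ↔ k₁.2 + k₃.2 = k.2 + k₄.2 := by
    constructor
    · intro h; linear_combination h
    · intro h; linear_combination h
  simp only [hfreq, hmom]

/-! ## §2 The time-integral Fourier form of the six-point insertion -/

/-- **THE TIME-INTEGRAL FOURIER FORM** (`β ≠ 0`, every `U`, every finite `(L, M)`):
`βL² · ∫e^{−V}(∂⁺_{k↑}W)(∂⁻_{k↑}W) = ∫₀^β Σ_z e^{−iω_k u} conj χ_{k⃗}(z) · ∫e^{−V}·sixPointWord L M β 0 1 z u du`. -/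
theorem sixPoint_up_eq_integral_word {β : ℝ} (hβ : β ≠ 0) (U μ : ℝ) (k : FreqMomentum L M) :
    ((β * (L : ℝ) ^ 2 : ℝ) : ℂ) *
        gaussExpect ℂ (hubbardCovariance L M β μ 0)
          (grassmannExp (-(hubbardInteraction L M β U)) *
            (grassmannDeriv ℂ (((k, 0), 0) : HubbardFieldIdx L M) (hubbardInteraction L M β 1) *
              grassmannDeriv ℂ (((k, 0), 1) : HubbardFieldIdx L M) (hubbardInteraction L M β 1))) =
      ∫ u in (0 : ℝ)..β, ∑ z : TorusSite 2 L,
        Complex.exp (-(((matsubaraFreq β M k.1 * u : ℝ) : ℂ) * Complex.I)) * conj (torusChar k.2 z) *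
          gaussExpect ℂ (hubbardCovariance L M β μ 0)
            (grassmannExp (-(hubbardInteraction L M β U)) * sixPointWord L M β 0 1 z u) := by
  set r : ℂ := (((1 / (β * (L : ℝ) ^ 2) ^ 3 : ℝ) : ℂ)) with hr
  set r' : ℂ := (((1 / (β * (L : ℝ) ^ 2)) ^ 3 : ℝ) : ℂ) with hr'
  have hrr : r' = r := by rw [hr, hr']; push_cast; ring
  set G : (FreqMomentum L M × FreqMomentum L M × FreqMomentum L M) → (FreqMomentum L M × FreqMomentum L M × FreqMomentum L M) → ℂ :=
    fun p q => gaussExpect ℂ (hubbardCovariance L M β μ 0)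
      (grassmannExp (-(hubbardInteraction L M β U)) *
        (psiMinus p.1 0 * (psiPlus p.2.1 1 * psiMinus p.2.2 1) * (psiPlus q.1 0 * (psiPlus q.2.1 1 * psiMinus q.2.2 1)))) with hG
  -- the per-(q) phase function and its integral
  set Φ : (FreqMomentum L M × FreqMomentum L M × FreqMomentum L M) → ℝ → ℂ := fun q u =>
    ∑ z : TorusSite 2 L,
      Complex.exp (-(((matsubaraFreq β M k.1 * u : ℝ) : ℂ) * Complex.I)) * conj (torusChar k.2 z) *
        ((((1 / (β * (L : ℝ) ^ 2) : ℝ) : ℂ) * conj (vertexPlaneWave L M β 0 q.1 z u)) *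
          ((((1 / (β * (L : ℝ) ^ 2) : ℝ) : ℂ) * conj (vertexPlaneWave L M β 0 q.2.1 z u)) *
            (((1 / (β * (L : ℝ) ^ 2) : ℝ) : ℂ) * conj (vertexPlaneWave L M β 1 q.2.2 z u)))) with hΦ
  have hΦcont : ∀ q, Continuous (Φ q) := by
    intro q
    refine continuous_finsetSum _ fun z _ => ?_
    have h0 := continuous_conj_vertexPlaneWave_time (L := L) (M := M) β 0 q.1 z
    have h1 := continuous_conj_vertexPlaneWave_time (L := L) (M := M) β 0 q.2.1 z
    have h2 := continuous_conj_vertexPlaneWave_time (L := L) (M := M) β 1 q.2.2 z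
    have he : Continuous fun u : ℝ => Complex.exp (-(((matsubaraFreq β M k.1 * u : ℝ) : ℂ) * Complex.I)) := by fun_prop
    exact ((he.mul continuous_const).mul ((continuous_const.mul h0).mul ((continuous_const.mul h1).mul (continuous_const.mul h2))))
  -- rewrite the integrand as a double label sum of `Φ q u * (r' * −G p q)`
  have hint : ∀ u : ℝ, (∑ z : TorusSite 2 L,
      Complex.exp (-(((matsubaraFreq β M k.1 * u : ℝ) : ℂ) * Complex.I)) * conj (torusChar k.2 z) *
        gaussExpect ℂ (hubbardCovariance L M β μ 0)
          (grassmannExp (-(hubbardInteraction L M β U)) * sixPointWord L M β 0 1 z u)) =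
      ∑ q : FreqMomentum L M × FreqMomentum L M × FreqMomentum L M,
        ∑ p : FreqMomentum L M × FreqMomentum L M × FreqMomentum L M, Φ q u * (r' * -G p q) := by
    intro u
    simp_rw [wordSixPoint_up_eq_sum, Finset.mul_sum]
    rw [Finset.sum_comm]
    refine Finset.sum_congr rfl fun q _ => ?_
    rw [Finset.sum_comm]
    refine Finset.sum_congr rfl fun p _ => ?_
    rw [hΦ, Finset.sum_mul]
    refine Finset.sum_congr rfl fun z _ => ?_
    ring
  simp_rw [hint]
  rw [intervalIntegral.integral_finsetSum
    (f := fun (q : FreqMomentum L M × FreqMomentum L M × FreqMomentum L M) (u : ℝ) =>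
      ∑ p : FreqMomentum L M × FreqMomentum L M × FreqMomentum L M, Φ q u * (r' * -G p q))
    fun q _ => (continuous_finsetSum _ fun p _ => (hΦcont q).mul continuous_const).intervalIntegrable _ _]
  have hinner : ∀ q : FreqMomentum L M × FreqMomentum L M × FreqMomentum L M,
      (∫ u in (0 : ℝ)..β, ∑ p : FreqMomentum L M × FreqMomentum L M × FreqMomentum L M, Φ q u * (r' * -G p q)) =
        ∑ p : FreqMomentum L M × FreqMomentum L M × FreqMomentum L M, (∫ u in (0 : ℝ)..β, Φ q u) * (r' * -G p q) := by
    intro q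
    rw [intervalIntegral.integral_finsetSum
      (f := fun (p : FreqMomentum L M × FreqMomentum L M × FreqMomentum L M) (u : ℝ) => Φ q u * (r' * -G p q))
      fun p _ => ((hΦcont q).mul continuous_const).intervalIntegrable _ _]
    refine Finset.sum_congr rfl fun p _ => ?_
    exact intervalIntegral.integral_mul_const _ _
  simp_rw [hinner]
  have hΦint : ∀ q : FreqMomentum L M × FreqMomentum L M × FreqMomentum L M, ∫ u in (0 : ℝ)..β, Φ q u =
      r' * ((if matsubaraInt M q.1.1 + matsubaraInt M q.2.1.1 = matsubaraInt M k.1 + matsubaraInt M q.2.2.1 then (β : ℂ) else 0) *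
        (if q.1.2 + q.2.1.2 = k.2 + q.2.2.2 then ((L : ℂ) ^ 2) else 0)) := fun q =>
    integral_sum_phases_currentBar_up hβ k q.1 q.2.1 q.2.2
  simp_rw [hΦint]
  -- the left side, expanded
  rw [sixPoint_up_eq_sum, hrr, Finset.sum_comm]
  simp_rw [Finset.mul_sum]
  refine Finset.sum_congr rfl fun q _ => Finset.sum_congr rfl fun p _ => ?_
  by_cases hcq : matsubaraInt M q.1.1 + matsubaraInt M q.2.1.1 = matsubaraInt M k.1 + matsubaraInt M q.2.2.1 ∧
      q.1.2 + q.2.1.2 = k.2 + q.2.2.2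
  · rw [if_pos hcq.1, if_pos hcq.2]
    by_cases hcp : matsubaraInt M k.1 + matsubaraInt M p.2.1.1 = matsubaraInt M p.1.1 + matsubaraInt M p.2.2.1 ∧
        k.2 + p.2.1.2 = p.1.2 + p.2.2.2
    · rw [if_pos hcp, if_pos hcq]
      simp only [hG, hr]
      push_cast
      ring
    · have hsel : G p q = 0 := by
        rw [hG]
        refine gaussExpect_boltzmann_sixMonomial_up_eq_zero β U μ fun hcomp => hcp ⟨?_, ?_⟩
        · have h1 := hcomp.1; have h2 := hcq.1; omega
        · linear_combination hcomp.2 - hcq.2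
      rw [if_neg hcp, hsel]
      ring
  · have h0 : (if matsubaraInt M q.1.1 + matsubaraInt M q.2.1.1 = matsubaraInt M k.1 + matsubaraInt M q.2.2.1 then (β : ℂ) else 0) *
        (if q.1.2 + q.2.1.2 = k.2 + q.2.2.2 then ((L : ℂ) ^ 2) else 0) = 0 := by
      rcases not_and_or.mp hcq with h | h
      · rw [if_neg h, zero_mul]
      · rw [if_neg h, mul_zero]
    rw [h0]
    split_ifs <;> ring

/-- **THE `L¹` MAJORANT** (`0 < β`): `βL² · ‖∫e^{−V}(∂⁺_{k↑}W)(∂⁻_{k↑}W)‖ ≤ ∫₀^β Σ_z ‖∫e^{−V}·sixPointWord L M β 0 1 z u‖ du` for EVERY label `k`. -/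
theorem norm_sixPoint_up_le_integral_word {β : ℝ} (hβ : 0 < β) (U μ : ℝ) (k : FreqMomentum L M)
    (hint : IntervalIntegrable (fun u : ℝ => ∑ z : TorusSite 2 L,
      ‖gaussExpect ℂ (hubbardCovariance L M β μ 0) (grassmannExp (-(hubbardInteraction L M β U)) * sixPointWord L M β 0 1 z u)‖)
      volume 0 β) :
    β * (L : ℝ) ^ 2 *
        ‖gaussExpect ℂ (hubbardCovariance L M β μ 0)
          (grassmannExp (-(hubbardInteraction L M β U)) *
            (grassmannDeriv ℂ (((k, 0), 0) : HubbardFieldIdx L M) (hubbardInteraction L M β 1) *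
              grassmannDeriv ℂ (((k, 0), 1) : HubbardFieldIdx L M) (hubbardInteraction L M β 1)))‖ ≤
      ∫ u in (0 : ℝ)..β, ∑ z : TorusSite 2 L,
        ‖gaussExpect ℂ (hubbardCovariance L M β μ 0) (grassmannExp (-(hubbardInteraction L M β U)) * sixPointWord L M β 0 1 z u)‖ := by
  have h := congrArg norm (sixPoint_up_eq_integral_word hβ.ne' U μ k)
  have hL : (0 : ℝ) < (L : ℝ) := by exact_mod_cast Nat.pos_of_ne_zero (NeZero.ne L)
  rw [norm_mul, Complex.norm_real, Real.norm_eq_abs, abs_of_pos (mul_pos hβ (pow_pos hL 2))] at h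
  rw [h]
  refine intervalIntegral.norm_integral_le_of_norm_le hβ.le ?_ hint
  refine Filter.Eventually.of_forall fun u => fun _ => (norm_sum_le _ _).trans (Finset.sum_le_sum fun z _ => ?_)
  rw [norm_mul, norm_mul, ← neg_mul, ← Complex.ofReal_neg, Complex.norm_exp_ofReal_mul_I, Complex.norm_conj, norm_torusChar,
    one_mul, one_mul]

end Summit.HubbardSuperconductivity.HubbardSuperconductivity.Theorems.TwoPointAssembly

end
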